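import Mathlib
import HarnessLib
import Summits.HubbardSuperconductivity.HubbardSuperconductivity.Theorems.KLProgrammeKLRegimeEngineScaleZeroDecay
import Summits.HubbardSuperconductivity.HubbardSuperconductivity.Theorems.KLProgrammeKLRegimeEngineV8DefsQ3

/-!
# KL programme (k = 3, c = 2, p1 g3) — ENGINE (E4)₀: the thresholds of `E4ScaleZeroAt` give the hypotheses of the scale-`0` numbers
# (packaging step (P5))

Helpers toward the item `KLRegimeEngineV16` (conjunct (E4)₀ of `stub_engine_scale0`).  The four numbers of (E4)₀
(`A_X`: `spaceMoment_scaleZero_of_frameOK`; `A_T`: `timeMoment_scaleZero_of_klEng`; `T_T`: `exists_timeMomentConst_klAnisoFamily_zero`;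
`T_X`: `spaceMoment_klAnisoFamily_zero_le`) ask for `2¹⁵ ≤ L`, `β³ ≤ M` (`pow_three_le_of_klEng`), `β ≤ M`, `klE0·β ≤ π(2M − 13)`,
`|U| ≤ 1` and `(16/15)·Gfr0·|U| ≤ 1/50`; this file derives them from the binders of `E4ScaleZeroAt`
(`klBetaMin ≤ β`, `klEngL₃ β U ≤ L`, `klEngM₃ β U L ≤ M`, `0 < U ≤ klEngU₀3 P R c`, `R.WF`):

* `two_pow_fifteen_le_of_klEngL`, `beta_le_of_klEng`, `klE0_mul_beta_le_of_klEng`;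
* `gfr_zero_le_klEngRsq`, `abs_le_one_of_klEngU₀3`, `gfr_zero_mul_abs_le_of_klEngU₀3`.
-/

noncomputable section

namespace Summit.HubbardSuperconductivity.HubbardSuperconductivity.Theorems.EngineV8

set_option linter.dupNamespace false -- summit = problem name (single-conjunct summit), D-0017

open Real Finset Literature.MathematicalPhysics.QuantumLattice
open Summit.HubbardSuperconductivity.HubbardSuperconductivity.Theorems.KLRegimeSplit
open Summit.HubbardSuperconductivity.HubbardSuperconductivity.Theorems.ScaleZeroDecay

variable {L M : ℕ} {β U : ℝ}

/-! ## §1 Space–time thresholds -/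

/-- `klEngL₃ β U ≤ L` with `klBetaMin ≤ β` gives `2¹⁵ ≤ L`. -/
theorem two_pow_fifteen_le_of_klEngL (hβ : klBetaMin ≤ β) (hL : klEngL₃ β U ≤ L) : (2 : ℝ) ^ 15 ≤ L := by
  unfold klEngL₃ at hL
  have h128 : (128 : ℝ) ≤ |β| := le_trans (by norm_num [klBetaMin]) (hβ.trans (le_abs_self β))
  have hc : (128 : ℕ) ≤ ⌈|β|⌉₊ := by
    have h1 : ((128 : ℕ) : ℝ) ≤ |β| := by push_cast; exact h128
    have h2 := Nat.ceil_mono h1  -- `⌈128⌉₊ ≤ ⌈|β|⌉₊`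
    simpa using h2
  have h1 : 2 ^ 15 ≤ 2 ^ 10 * (⌈|β|⌉₊ + 1) ^ 2 * (⌈|U|⁻¹⌉₊ + 1) ^ 2 := by
    have h2 : 129 ^ 2 ≤ (⌈|β|⌉₊ + 1) ^ 2 := Nat.pow_le_pow_left (by omega) 2
    have h3 : 1 ≤ (⌈|U|⁻¹⌉₊ + 1) ^ 2 := Nat.one_le_pow _ _ (by omega)
    calc 2 ^ 15 ≤ 2 ^ 10 * 129 ^ 2 * 1 := by norm_num
      _ ≤ 2 ^ 10 * (⌈|β|⌉₊ + 1) ^ 2 * (⌈|U|⁻¹⌉₊ + 1) ^ 2 := Nat.mul_le_mul (Nat.mul_le_mul_left _ h2) h3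
  exact_mod_cast h1.trans hL

/-- `β ≤ M` under the thresholds. -/
theorem beta_le_of_klEng (hβ : klBetaMin ≤ β) (hL : klEngL₃ β U ≤ L) (hM : klEngM₃ β U L ≤ M) : β ≤ (M : ℝ) := by
  have h3 := pow_three_le_of_klEng hβ hL hM
  have hβ1 : (1 : ℝ) ≤ β := le_trans (by norm_num [klBetaMin]) hβ
  calc β ≤ β ^ 3 := by nlinarith [pow_pos (by linarith : (0:ℝ) < β) 2, sq_nonneg β]
    _ ≤ M := h3

/-- `klE0·β ≤ π(2M − 13)` under the thresholds. -/
theorem klE0_mul_beta_le_of_klEng (hβ : klBetaMin ≤ β) (hL : klEngL₃ β U ≤ L) (hM : klEngM₃ β U L ≤ M) :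
    klE0 * β ≤ Real.pi * (2 * (M : ℝ) - 13) := by
  have h3 := pow_three_le_of_klEng hβ hL hM
  have hβ128 : (128 : ℝ) ≤ β := le_trans (by norm_num [klBetaMin]) hβ
  have hE : (klE0 : ℝ) = 1 / 32 := by norm_num [klE0]
  have hπ3 : (3 : ℝ) < Real.pi := Real.pi_gt_three
  have hb3 : (128 : ℝ) ^ 2 * β ≤ β ^ 3 := by
    have : (128 : ℝ) ^ 2 ≤ β ^ 2 := by nlinarith
    nlinarith
  have hM : (128 : ℝ) ^ 2 * β ≤ M := hb3.trans h3
  rw [hE]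
  nlinarith

/-! ## §2 Coupling thresholds -/

/-- `Gfr 0 ≤ klEngRsq R` (`R.WF`). -/
theorem gfr_zero_le_klEngRsq {R : RenConsts} (hRwf : R.WF) : R.Gfr 0 ≤ klEngRsq R := by
  have hG0 : 0 ≤ R.Gfr 0 := hRwf.2.2 0
  have hsum : R.Gfr 0 ^ 2 ≤ ∑ j ∈ range 5, R.Gfr j ^ 2 :=
    single_le_sum (f := fun j => R.Gfr j ^ 2) (fun j _ => sq_nonneg _) (by simp)
  unfold klEngRsq
  nlinarith [sq_nonneg R.cr, sq_nonneg R.cz, sq_nonneg (R.Gfr 0 - 1)]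

/-- `0 < U ≤ klEngU₀3 P R c` gives `|U| ≤ 1`. -/
theorem abs_le_one_of_klEngU₀3 {P : SplitConsts} {R : RenConsts} {c : ℝ} (hU0 : 0 < U) (hU : U ≤ klEngU₀3 P R c) : |U| ≤ 1 := by
  have hP := one_le_klEngPsq P
  have hR := one_le_klEngRsq R
  rw [abs_of_pos hU0]
  refine hU.trans ?_
  unfold klEngU₀3
  rw [div_le_one (by positivity)]
  have h1 : (1 : ℝ) ≤ 2 ^ 120 := by norm_num
  have h2 : (1 : ℝ) ≤ klEngPsq P ^ 2 := one_le_pow₀ hP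
  have h3 : (1 : ℝ) ≤ klEngRsq R ^ 4 := one_le_pow₀ hR
  have h4 : (1 : ℝ) ≤ c ^ 2 + 1 := by nlinarith [sq_nonneg c]
  calc (1 : ℝ) = 1 * 1 * 1 * 1 := by ring
    _ ≤ 2 ^ 120 * klEngPsq P ^ 2 * klEngRsq R ^ 4 * (c ^ 2 + 1) := by gcongr

/-- `0 < U ≤ klEngU₀3 P R c` and `R.WF` give `(16/15)·Gfr0·|U| ≤ 1/50`. -/
theorem gfr_zero_mul_abs_le_of_klEngU₀3 {P : SplitConsts} {R : RenConsts} {c : ℝ} (hRwf : R.WF) (hU0 : 0 < U)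
    (hU : U ≤ klEngU₀3 P R c) : 16 / 15 * (R.Gfr 0 * |U|) ≤ 1 / 50 := by
  have hP := one_le_klEngPsq P
  have hR := one_le_klEngRsq R
  have hG0 : 0 ≤ R.Gfr 0 := hRwf.2.2 0
  have hGR := gfr_zero_le_klEngRsq hRwf
  rw [abs_of_pos hU0]
  -- `Gfr0·U ≤ Rsq·U₀ ≤ Rsq/(2^120 Rsq⁴) ≤ 2^{-120}`
  have h1 : R.Gfr 0 * U ≤ klEngRsq R * klEngU₀3 P R c := mul_le_mul hGR hU hU0.le (by linarith)
  have h2 : klEngRsq R * klEngU₀3 P R c ≤ 1 / 2 ^ 120 := by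
    unfold klEngU₀3
    rw [mul_one_div, div_le_div_iff₀ (by positivity) (by positivity), one_mul]
    have h3 : (1 : ℝ) ≤ klEngPsq P ^ 2 := one_le_pow₀ hP
    have h4 : (1 : ℝ) ≤ c ^ 2 + 1 := by nlinarith [sq_nonneg c]
    have h5 : klEngRsq R ≤ klEngRsq R ^ 4 := by
      calc klEngRsq R = klEngRsq R ^ 1 := (pow_one _).symm
        _ ≤ klEngRsq R ^ 4 := pow_le_pow_right₀ hR (by norm_num)
    calc klEngRsq R * 2 ^ 120 = 2 ^ 120 * 1 * klEngRsq R * 1 := by ring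
      _ ≤ 2 ^ 120 * klEngPsq P ^ 2 * klEngRsq R ^ 4 * (c ^ 2 + 1) := by gcongr
  nlinarith

/-! ## §3 The frame size `S = 1 + Gfr0 + Gfr1 + Gfr2 + Gfr3` against `klEngRsq` -/

/-- **`S⁴ ≤ 25·klEngRsq²`** for `S = 1 + Gfr0 + Gfr1 + Gfr2 + Gfr3` (Cauchy–Schwarz with five terms): the `R`-dependent corrections
of the scale-`0` moments (`…S⁴·((N_sc+1)U² + 2|U|)`) are absorbed by `Q.cE4·U² = 2^{60}·klEngPsq²·klEngRsq²·U²`. -/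
theorem frameSize_pow_four_le_klEngRsq_sq (R : RenConsts) :
    (1 + R.Gfr 0 + R.Gfr 1 + R.Gfr 2 + R.Gfr 3) ^ 4 ≤ 25 * klEngRsq R ^ 2 := by
  have hsum : ∑ j ∈ range 5, R.Gfr j ^ 2 = R.Gfr 0 ^ 2 + R.Gfr 1 ^ 2 + R.Gfr 2 ^ 2 + R.Gfr 3 ^ 2 + R.Gfr 4 ^ 2 := by
    simp [sum_range_succ]
  have hS2 : (1 + R.Gfr 0 + R.Gfr 1 + R.Gfr 2 + R.Gfr 3) ^ 2 ≤ 5 * klEngRsq R := by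
    unfold klEngRsq
    rw [hsum]
    nlinarith [sq_nonneg (1 - R.Gfr 0), sq_nonneg (1 - R.Gfr 1), sq_nonneg (1 - R.Gfr 2), sq_nonneg (1 - R.Gfr 3),
      sq_nonneg (R.Gfr 0 - R.Gfr 1), sq_nonneg (R.Gfr 0 - R.Gfr 2), sq_nonneg (R.Gfr 0 - R.Gfr 3), sq_nonneg (R.Gfr 1 - R.Gfr 2),
      sq_nonneg (R.Gfr 1 - R.Gfr 3), sq_nonneg (R.Gfr 2 - R.Gfr 3), sq_nonneg R.cr, sq_nonneg R.cz, sq_nonneg (R.Gfr 4)]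
  have h0 : 0 ≤ (1 + R.Gfr 0 + R.Gfr 1 + R.Gfr 2 + R.Gfr 3) ^ 2 := sq_nonneg _
  calc (1 + R.Gfr 0 + R.Gfr 1 + R.Gfr 2 + R.Gfr 3) ^ 4 = ((1 + R.Gfr 0 + R.Gfr 1 + R.Gfr 2 + R.Gfr 3) ^ 2) ^ 2 := by ring
    _ ≤ (5 * klEngRsq R) ^ 2 := pow_le_pow_left₀ h0 hS2 2
    _ = 25 * klEngRsq R ^ 2 := by ring

end Summit.HubbardSuperconductivity.HubbardSuperconductivity.Theorems.EngineV8

end
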